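import Summits.AtomisticToContinuum.Crystallization.Theorems.ChessboardParticlePlanesLjBilayerHcpStubHcpPowerSums
import Summits.AtomisticToContinuum.Crystallization.Theorems.ChessboardParticlePlanesLjBilayerHcpStubPowerSumsAntitone
import Summits.AtomisticToContinuum.Crystallization.Theorems.ChessboardParticlePlanesLjBilayerHcpStubPowerSumTail
import Summits.AtomisticToContinuum.Crystallization.Theorems.ChessboardParticlePlanesLjBilayerHcpNumericReduction
import Summits.AtomisticToContinuum.Crystallization.Theorems.ChessboardParticlePlanesLjBilayerHcpStubCertificate

/-!
# Crux `ChessboardParticlePlanes.LjBilayerHcp` (stmt-AtomisticToContinuum-6710), line `Sketch` —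
# the NUMERIC FACE Sν is a theorem: the relaxed-hcp Lennard-Jones energy over the class is minimised inside the box

`stub_numeric` (registered stub Sν of the line): for every `hcp(a, h)` with `a ≥ 2/3`, `h ≥ 3/4` there is an hcp
`(a', h')` of the box `47/50 ≤ a' ≤ 1`, `39/50·a' ≤ h' ≤ 17/20·a'` with
`e_LJ(hcp a' h') ≤ e_LJ(hcp a h)` (`e = PeriodicConfiguration.energyPerParticle lennardJones`, Blanc–Lewin 2015 (23);
`hcpPeriodicConfiguration` of `BarlowStacking.lean`).

Proof = the line's one-dimensional reduction, all landed: N1 `stub_hcpPowerSums` (p129719), N2 `stub_powerSums_antitone`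
(p129717), N5 `stub_powerSum_tail` (p130234) feed `numeric_of_certificate` (p130319) together with the COMPUTATIONAL
certificate `stub_certificate` (p131061, `native_decide` on floor-rounded rational box sums).  This is the fact every
hcp-targeted statement of the sub-problem (`HcpPeriodicMinimiser`, stmt-3061) silently needs: the witness `(a, h)` of the
box is not beaten by an hcp of the class outside the box.  [folklore; computation inside `stub_certificate`]
-/

noncomputable section

open Literature.MathematicalPhysics.StatisticalMechanics

namespace Summit.AtomisticToContinuum.Crystallization.Theorems.LjBilayerHcpSketch

/-- **Sν, the numeric face of crux `LjBilayerHcp` (registered stub `stub_numeric` of line `Sketch`):** every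
`hcp(a, h)` with `a ≥ 2/3`, `h ≥ 3/4` is beaten by some hcp of the box `[47/50, 1] × [39a'/50, 17a'/20]`.
[folklore; computation inside `stub_certificate`] -/
theorem stub_numeric :
    ∀ a h : ℝ, ∀ (ha : a ≠ 0) (hh : h ≠ 0), 2 / 3 ≤ a → 3 / 4 ≤ h →
      ∃ a' h' : ℝ, ∃ (ha' : a' ≠ 0) (hh' : h' ≠ 0),
        47 / 50 ≤ a' ∧ a' ≤ 1 ∧ 39 / 50 * a' ≤ h' ∧ h' ≤ 17 / 20 * a' ∧
        (hcpPeriodicConfiguration ha' hh').energyPerParticle lennardJones ≤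
          (hcpPeriodicConfiguration ha hh).energyPerParticle lennardJones := by
  -- the three abbreviations, spelled once
  let Q : ℤ × ℤ × ℤ → ℝ := fun v => (v.2.1 : ℝ) ^ 2 + (v.2.1 : ℝ) * v.2.2 + (v.2.2 : ℝ) ^ 2 +
      (if Even v.1 then 0 else ((v.2.1 : ℝ) + v.2.2 + 1 / 3))
  let Bx : ℕ → ℝ → ℝ := fun n x =>
    ∑ v ∈ Finset.Icc (-12 : ℤ) 12 ×ˢ (Finset.Icc (-12 : ℤ) 12 ×ˢ Finset.Icc (-12 : ℤ) 12),
      if v = 0 then (0 : ℝ) else ((Q v + (v.1 : ℝ) ^ 2 * x ^ 2)⁻¹) ^ n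
  let T : ℝ → ℝ := fun x => (∑ k ∈ Finset.Icc (-((12 : ℕ) : ℤ)) ((12 : ℕ) : ℤ),
        (4608 : ℝ) / (5 * ((3 * ((12 : ℕ) : ℝ) - 2) ^ 2 + 12 * (k : ℝ) ^ 2 * x ^ 2) ^ 2)) +
        64 / (15 * ((12 : ℕ) : ℝ) ^ 3 * x ^ 4) + 18 / (5 * ((12 : ℕ) : ℝ) ^ 5 * x ^ 6)
  have hQ : Q = fun v => (v.2.1 : ℝ) ^ 2 + (v.2.1 : ℝ) * v.2.2 + (v.2.2 : ℝ) ^ 2 +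
      (if Even v.1 then 0 else ((v.2.1 : ℝ) + v.2.2 + 1 / 3)) := rfl
  have h1 := stub_hcpPowerSums Q hQ
  have h2 := stub_powerSums_antitone Q hQ
  have h5 : ∀ (t : ℝ), 0 < t →
      (∑' v : ℤ × ℤ × ℤ,
          if (|v.1| ≤ ((12 : ℕ) : ℤ) ∧ |v.2.1| ≤ ((12 : ℕ) : ℤ) ∧ |v.2.2| ≤ ((12 : ℕ) : ℤ)) then (0 : ℝ)
          else if v = 0 then (0 : ℝ) else (((1 : ℝ) ^ 2 * Q v + (v.1 : ℝ) ^ 2 * t ^ 2)⁻¹) ^ 3) ≤ T t :=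
    fun t ht => stub_powerSum_tail Q hQ t 12 12 ht (by norm_num) (by norm_num)
  have hc := stub_certificate Q hQ Bx rfl T rfl
  exact numeric_of_certificate Q hQ Bx rfl T h1 h2 h5 hc

end Summit.AtomisticToContinuum.Crystallization.Theorems.LjBilayerHcpSketch

end
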